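import Summits.Ventures.CertifiedQuantumChemistry.Rows.APosterioriLowerBoundConditions
import Literature.Computation.Certificates.SemidefiniteRigorousBoundsNegSplit
import HarnessLib

/-!
# Ventures/CertifiedQuantumChemistry — Rows/APosterioriLowerBoundNegSplit.lean: the a-posteriori bridge with
# a-priori OPERATOR bounds and a negative-part split of the multipliers (LADDER-CHEM I-TYPE slot 08)

HONEST FRAMING (verbatim, page 1 of every file of the cell): certified bounds for a stated model
Hamiltonian in a stated basis; not a claim about the real molecule or material beyond that model.

WHAT THIS FILE IS. The Rows-side TWIN of `APosteriori.lowerRow_of_isSectorRelaxationLMI` /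
`APosteriori.lowerRow_of_isEncodingOfLMI` (`Rows/APosterioriLowerBound{,Conditions}.lean`, p457053 /
p458926) for the certificate kind of `Literature/Computation/Certificates/SemidefiniteRigorousBoundsNegSplit.lean`
(certnum-sdp-1, p484952): `JanssonChaykinKeil.lmiForm_bound_negSplit` — the inequality-form rigorous
SDP lower bound in which every PSD block `k` carries, besides its trace bound `tr M_k(y) ≤ τ_k`, an
a-priori OPERATOR bound `M_k(y) ⪯ x̄_k · 1` (Jansson 2007 Cor. 6.1, primal boundedness qualification
(ii): "there exists a nonnegative number `x̄` such that for every `ε > 0` there exists a primal feasible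
solution `X(ε) ≤ x̄ · I`" [p0013]) and the dual multiplier is certified in the SPLIT form
`Z_k + W_k W_kᵀ − d_k · 1 ⪰ 0` with an explicit factor `W_k` of the subtracted (negative) part, paying
the penalty `x̄_k · tr(W_kᵀ W_k)` (the factor form of Jansson's Thm 4.3 (a) / Cor. 6.1 (a)
`⟨D⁻, X⟩ ≥ l · d⁻ · x̄`) instead of `|d⁻| · τ_k` for that part. The chem-side a-priori constants `x̄_k`
are the tree's operator bounds on the RELAXED feasible sets — `γ ⪯ 1`, `1 − γ ⪯ 1`, `Γ ⪯ N`,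
`Q ⪯ r − N`, `G ⪯ N` (`GarrodPercusEigenvalueBound{,Real}.lean`), `T1 ⪯ 9N + 6`, `T2 ⪯ N(r+2)`,
`T2′ ⪯ N(r+2) + 1` (`T1OperatorBound.lean`, `T2OperatorBound.lean`, `T2PrimeOperatorBound.lean`,
`ThreeIndexOperatorBoundsReal.lean`) — valid a fortiori at the image of any state. What is added here
(nothing printed is restated; the generic bound is IMPORTED):

* `APosteriori.IsSectorRelaxationLMIOp F a b … ρ τ xb` — the state-level LMI encoding predicate of the
  sibling WITH operator bounds: every unit vector of the `(a, b)` sector has a feasible image `y` with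
  `tr M_q(y) ≤ τ_q`, `M_q(y) ⪯ x̄_q · 1` and objective `≤ Re ⟨ψ, H_F ψ⟩`; it forgets to
  `IsSectorRelaxationLMI` (`IsSectorRelaxationLMIOp.isSectorRelaxationLMI`). Asserts nothing.
* **`APosteriori.lowerRow_of_isSectorRelaxationLMIOp_negSplit`** — THE BRIDGE: under the predicate
  (symmetric `F`, `a, b ≤ k`), a certificate `(λ, κ ≥ 0, Z_q, W_q, d_q)` with
  `Z_q + W_q W_qᵀ − d_q · 1 ⪰ 0` and exact residuals `r_v` proves `LowerRow F a b lo` for every rational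
  `lo ≤ β − Σ_{v≠u} |r_v| ρ_v − Σ_q |min(0, d_q)| τ_q − Σ_q x̄_q tr(W_qᵀ W_q)`
  (`lmiForm_bound_negSplit` at the image of the sector ground state); `…_negSplit_card` — the same
  with the floor penalty `|min(0, d_q)| · s_q · x̄_q` when no trace bound is used.
* `APosteriori.IsEncodingOfLMIOp F P … ρ τ xb` — the pair-level form for an ARBITRARY condition set
  `P` (as `IsEncodingOfLMI`): every `P`-feasible pair has a feasible image with the trace AND operator
  bounds and objective `≤ Re E[γ, Γ]`; `.anti` (stronger lists), `.isEncodingOfLMI` (forget),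
  `.isSectorRelaxationLMIOp` (a sector-necessary `P` gives the state-level predicate), and the bridges
  **`APosteriori.lowerRow_of_isEncodingOfLMIOp_negSplit{,_card}`**.
* `APosteriori.posSemidef_smul_one_sub_submatrix` — plumbing an encoder needs to DISCHARGE the
  operator clause from the tree's constants: a Löwner bound `x̄ · 1 − A ⪰ 0` passes to every
  re-indexed principal block `x̄ · 1 − A.submatrix e e ⪰ 0` (`e` injective).

WHAT THIS FILE IS NOT: not a restatement of Jansson–Chaykin–Keil / Jansson 2007 (imported via the
certnum file); not a proof that a given generator's programme satisfies the predicate (per generator,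
outside this file — the operator clause is discharged block by block from the Literature constants and
`posSemidef_smul_one_sub_submatrix`); not a statement about floating point (every datum is an exact
real; the verifier certifies `Z_q + W_q W_qᵀ ⪰ d_q · 1` exactly as it certifies `Z_q ⪰ d_q · 1` today);
no number. Everything below is PROVED (0 sorry); the two `def`s are parametrised predicates.

References (pages opened 2026-08-27 by chem-type-08 gen 4): C. Jansson, arXiv:0707.4366 (2007) §6
Cor. 6.1 with PBQ (ii) `X(ε) ≤ x̄ · I` and (a) `f̂_p ≥ bᵀỹ + l · d⁻ · x̄`, proof via Thm 4.2 (a) and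
`⟨D̲⁻, X̄⟩` [corpus:paper:arxiv-0707.4366 p0013 L42–L82] [Jansson2007]; C. Jansson, D. Chaykin, C. Keil,
SIAM J. Numer. Anal. 46 (2007/08) 180 [JanssonChaykinKeil2008] (cited through the tree files; text =
acq-09252); E. Cancès, G. Stoltz, M. Lewin (2006) §3 eqs. (7)–(10) for `𝒞_app ⊃ 𝒞_N ⇒ E_app ≤ E`
(through `IsNecessaryInSector`, chem-type-07's `DualConeLowerBound.lean`).
-/

namespace Summit.Ventures.CertifiedQuantumChemistry

open Matrix Finset
open Literature.MathematicalPhysics.QuantumLattice Literature.MathematicalPhysics.QuantumChemistry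
open Literature.Computation.Certificates

namespace APosteriori

variable {k : ℕ}

/-! ## Plumbing: a Löwner bound passes to re-indexed principal blocks -/

/-- **Discharging the operator clause block by block.** If `x̄ · 1 − A ⪰ 0` (`λ_max(A) ≤ x̄`) then for
every injective re-indexing `e` the principal block satisfies `x̄ · 1 − A.submatrix e e ⪰ 0` — how an
encoder turns the tree's constants (`N · 1 − Re Γ ⪰ 0`, `(9N+6) · 1 − Re T1 ⪰ 0`, …, and their spin /
compacted sub-blocks) into the hypothesis `M_q(y) ⪯ x̄_q · 1` of the programme's own block indexing.
[folklore] -/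
theorem posSemidef_smul_one_sub_submatrix {m l R : Type*} [Fintype m] [DecidableEq m] [Fintype l]
    [DecidableEq l] [CommRing R] [PartialOrder R] [StarRing R] [StarOrderedRing R] (c : R)
    {A : Matrix m m R} (h : (c • (1 : Matrix m m R) - A).PosSemidef) {e : l → m}
    (he : Function.Injective e) : (c • (1 : Matrix l l R) - A.submatrix e e).PosSemidef := by
  have hsub := h.submatrix e
  have heq : (c • (1 : Matrix m m R) - A).submatrix e e = c • (1 : Matrix l l R) - A.submatrix e e := by
    ext i j
    simp only [submatrix_apply, Matrix.sub_apply, Matrix.smul_apply, Matrix.one_apply, he.eq_iff]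
  rwa [heq] at hsub

/-! ## State-level LMI encoding with operator bounds, and the bridge -/

section LMIFormOp

variable {V : Type*} [Fintype V] [DecidableEq V] {E : Type*} [Fintype E] {I : Type*} [Fintype I]
  {K : Type*} [Fintype K] {σ : K → Type*} [∀ q, Fintype (σ q)] [∀ q, DecidableEq (σ q)]
  {ω : K → Type*} [∀ q, Fintype (ω q)]

/-- **ENCODING PREDICATE (LMI form) WITH A-PRIORI OPERATOR BOUNDS.** As
`APosteriori.IsSectorRelaxationLMI` (variables `y : V → ℝ` with `y_u = 1`, objective `Σ_v c_v y_v + c₀`,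
boxes `|y_v| ≤ ρ_v` for `v ≠ u`, equality / inequality rows, blocks `M_q(y) = C_q + Σ_v y_v F_{q,v} ⪰ 0`
with trace bounds `tr M_q(y) ≤ τ_q`), and IN ADDITION every feasible image satisfies the operator bounds
`M_q(y) ⪯ x̄_q · 1` — Jansson's primal boundedness qualification in the eigenvalue form of Cor. 6.1 (ii)
("there exists a nonnegative number `x̄` such that … a primal feasible solution `X(ε) ≤ x̄ · I`"),
one constant per block. RELAXES the `(a, b)` sector energy of `F`: every unit vector of the sector has
such an image with objective `≤ Re ⟨ψ, H_F ψ⟩`. Asserts nothing.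
[cite: Jansson2007, §6 Cor. 6.1 (ii), p0013] [cite: Mazziotti2007RDMChapter, Ch. 3 §III eqs. (107)-(108), p.54] -/
def IsSectorRelaxationLMIOp (F : Model k) (a b : ℕ) (c : V → ℝ) (c₀ : ℝ) (u : V)
    (rowE : E → V → ℝ) (rhs : E → ℝ) (rowI : I → V → ℝ) (upper : I → ℝ)
    (Cb : ∀ q, Matrix (σ q) (σ q) ℝ) (Fm : ∀ q, V → Matrix (σ q) (σ q) ℝ) (ρ : V → ℝ)
    (τ : K → ℝ) (xb : K → ℝ) : Prop :=
  ∀ ψ : Fock (Orb (Fin k)), IsInSector a b ψ → star ψ ⬝ᵥ ψ = 1 →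
    ∃ y : V → ℝ, y u = 1 ∧ (∀ v, v ≠ u → |y v| ≤ ρ v) ∧ (∀ r, ∑ v, rowE r v * y v = rhs r) ∧
      (∀ i, ∑ v, rowI i v * y v ≤ upper i) ∧ (∀ q, (Cb q + ∑ v, y v • Fm q v).PosSemidef) ∧
      (∀ q, (Cb q + ∑ v, y v • Fm q v).trace ≤ τ q) ∧
      (∀ q, (xb q • (1 : Matrix (σ q) (σ q) ℝ) - (Cb q + ∑ v, y v • Fm q v)).PosSemidef) ∧
      ∑ v, c v * y v + c₀ ≤ (star ψ ⬝ᵥ F.hamiltonian *ᵥ ψ).re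

omit [DecidableEq V] [Fintype E] [Fintype I] [Fintype K] in
/-- Forgetting the operator bounds gives the sibling's encoding predicate `IsSectorRelaxationLMI`
(so every trace-form bridge applies as well). [cite: Jansson2007, §6 Cor. 6.1 (ii), p0013] -/
theorem IsSectorRelaxationLMIOp.isSectorRelaxationLMI {F : Model k} {a b : ℕ} {c : V → ℝ} {c₀ : ℝ}
    {u : V} {rowE : E → V → ℝ} {rhs : E → ℝ} {rowI : I → V → ℝ} {upper : I → ℝ}
    {Cb : ∀ q, Matrix (σ q) (σ q) ℝ} {Fm : ∀ q, V → Matrix (σ q) (σ q) ℝ} {ρ : V → ℝ} {τ : K → ℝ}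
    {xb : K → ℝ} (h : IsSectorRelaxationLMIOp F a b c c₀ u rowE rhs rowI upper Cb Fm ρ τ xb) :
    IsSectorRelaxationLMI F a b c c₀ u rowE rhs rowI upper Cb Fm ρ τ := by
  intro ψ hψ hψ1
  obtain ⟨y, hyu, hρ, heq, hineq, hpsd, hτ, -, hobj⟩ := h ψ hψ hψ1
  exact ⟨y, hyu, hρ, heq, hineq, hpsd, hτ, hobj⟩

/-- **THE BRIDGE (LMI form, negative-part split).** Under `IsSectorRelaxationLMIOp` (symmetric `F`,
`a, b ≤ k`), a certificate consisting of equality-row multipliers `λ_e` (free), inequality-row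
multipliers `κ_i ≥ 0`, block multipliers `Z_q` WITH SPLIT FACTORS `W_q` and floors `d_q` such that
`Z_q + W_q W_qᵀ − d_q · 1 ⪰ 0` (the verifier certifies the part `P_q = Z_q + W_q W_qᵀ`), and the EXACT
stationarity residuals `r_v = c_v − Σ_e λ_e rowE_e[v] + Σ_i κ_i rowI_i[v] − Σ_q ⟨Z_q, F_{q,v}⟩`
(computed with `Z_q` itself), `β = c₀ + r_u + Σ_e λ_e rhs_e − Σ_i κ_i upper_i − Σ_q ⟨Z_q, C_q⟩`, proves
`LowerRow F a b lo` for every rational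
`lo ≤ β − Σ_{v ≠ u} |r_v| ρ_v − Σ_q |min(0, d_q)| τ_q − Σ_q x̄_q · tr(W_qᵀ W_q)` — the tree's
`JanssonChaykinKeil.lmiForm_bound_negSplit` at the feasible image of the sector ground state. With
all `W_q = 0` this is the sibling's `lowerRow_of_isSectorRelaxationLMI`; the split penalty is Jansson's
`l · d⁻ · x̄` (Cor. 6.1 (a)) in factor form, never larger than it when `W_q` carries the negative
eigen-directions. NOT COVERED: the float producer of `(λ, κ, Z, W)`, the certification of `d_q`, the
per-generator encoding property. [cite: Jansson2007, §6 Cor. 6.1 (a), p0013 (via tree decl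
`JanssonChaykinKeil.lmiForm_bound_negSplit`)] [cite: JanssonChaykinKeil2008, Lemma 3.1 / Thm 3.2] -/
theorem lowerRow_of_isSectorRelaxationLMIOp_negSplit {F : Model k} (hF : F.IsSymmetric) {a b : ℕ}
    (ha : a ≤ k) (hb : b ≤ k) {c : V → ℝ} {c₀ : ℝ} {u : V} {rowE : E → V → ℝ} {rhs : E → ℝ}
    {rowI : I → V → ℝ} {upper : I → ℝ} {Cb : ∀ q, Matrix (σ q) (σ q) ℝ}
    {Fm : ∀ q, V → Matrix (σ q) (σ q) ℝ} {ρ : V → ℝ} {τ : K → ℝ} {xb : K → ℝ}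
    (hrel : IsSectorRelaxationLMIOp F a b c c₀ u rowE rhs rowI upper Cb Fm ρ τ xb)
    (lam : E → ℝ) (κ : I → ℝ) (hκ : ∀ i, 0 ≤ κ i) (Z : ∀ q, Matrix (σ q) (σ q) ℝ)
    (W : ∀ q, Matrix (σ q) (ω q) ℝ) (dZ : K → ℝ)
    (hZ : ∀ q, (Z q + W q * (W q)ᵀ - dZ q • (1 : Matrix (σ q) (σ q) ℝ)).PosSemidef) (r : V → ℝ)
    (hr : ∀ v, r v = c v - ∑ e, lam e * rowE e v + ∑ i, κ i * rowI i v - ∑ q, (Z q * Fm q v).trace)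
    (β : ℝ)
    (hβ : β = c₀ + r u + ∑ e, lam e * rhs e - ∑ i, κ i * upper i - ∑ q, (Z q * Cb q).trace)
    {lo : ℚ}
    (hlo : ((lo : ℚ) : ℝ) ≤ β - ∑ v ∈ Finset.univ.erase u, |r v| * ρ v
      - ∑ q, |min 0 (dZ q)| * τ q - ∑ q, xb q * ((W q)ᵀ * W q).trace) :
    LowerRow F a b lo := by
  obtain ⟨ψ, hψ, hψ1, hHψ⟩ := exists_unit_eigen_sectorGroundEnergy
    (Model.hamiltonian_isHermitian hF) (by simpa using ha) (by simpa using hb)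
  obtain ⟨y, hyu, hρ, heq, hineq, hpsd, hτ, hxb, hobj⟩ := hrel ψ hψ hψ1
  have hjck := JanssonChaykinKeil.lmiForm_bound_negSplit c c₀ u rowE rhs rowI upper Cb Fm ρ τ xb hyu
    hρ heq hineq hpsd hτ hxb lam κ hκ Z W dZ hZ r hr β hβ
  have hE := energy_eq_re_rayleigh_of_eigen (F := F) (a := a) (b := b) hψ1 hHψ
  exact ⟨ha, hb, by linarith⟩

/-- **The same bridge without using the trace bounds**: the floor penalty reads
`|min(0, d_q)| · s_q · x̄_q` (`s_q` the block dimension; Jansson–Chaykin–Keil Lemma 3.1 as printed,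
`s · d⁻ · x̄`), via the tree's `JanssonChaykinKeil.lmiForm_bound_negSplit_card`.
[cite: JanssonChaykinKeil2008, Lemma 3.1 / Thm 3.2 (via tree decl `lmiForm_bound_negSplit_card`)]
[cite: Jansson2007, §6 Cor. 6.1 (a), p0013] -/
theorem lowerRow_of_isSectorRelaxationLMIOp_negSplit_card {F : Model k} (hF : F.IsSymmetric)
    {a b : ℕ} (ha : a ≤ k) (hb : b ≤ k) {c : V → ℝ} {c₀ : ℝ} {u : V} {rowE : E → V → ℝ}
    {rhs : E → ℝ} {rowI : I → V → ℝ} {upper : I → ℝ} {Cb : ∀ q, Matrix (σ q) (σ q) ℝ}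
    {Fm : ∀ q, V → Matrix (σ q) (σ q) ℝ} {ρ : V → ℝ} {τ : K → ℝ} {xb : K → ℝ}
    (hrel : IsSectorRelaxationLMIOp F a b c c₀ u rowE rhs rowI upper Cb Fm ρ τ xb)
    (lam : E → ℝ) (κ : I → ℝ) (hκ : ∀ i, 0 ≤ κ i) (Z : ∀ q, Matrix (σ q) (σ q) ℝ)
    (W : ∀ q, Matrix (σ q) (ω q) ℝ) (dZ : K → ℝ)
    (hZ : ∀ q, (Z q + W q * (W q)ᵀ - dZ q • (1 : Matrix (σ q) (σ q) ℝ)).PosSemidef) (r : V → ℝ)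
    (hr : ∀ v, r v = c v - ∑ e, lam e * rowE e v + ∑ i, κ i * rowI i v - ∑ q, (Z q * Fm q v).trace)
    (β : ℝ)
    (hβ : β = c₀ + r u + ∑ e, lam e * rhs e - ∑ i, κ i * upper i - ∑ q, (Z q * Cb q).trace)
    {lo : ℚ}
    (hlo : ((lo : ℚ) : ℝ) ≤ β - ∑ v ∈ Finset.univ.erase u, |r v| * ρ v
      - ∑ q, |min 0 (dZ q)| * (Fintype.card (σ q) * xb q) - ∑ q, xb q * ((W q)ᵀ * W q).trace) :
    LowerRow F a b lo := by
  obtain ⟨ψ, hψ, hψ1, hHψ⟩ := exists_unit_eigen_sectorGroundEnergy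
    (Model.hamiltonian_isHermitian hF) (by simpa using ha) (by simpa using hb)
  obtain ⟨y, hyu, hρ, heq, hineq, hpsd, -, hxb, hobj⟩ := hrel ψ hψ hψ1
  have hjck := JanssonChaykinKeil.lmiForm_bound_negSplit_card c c₀ u rowE rhs rowI upper Cb Fm ρ xb
    hyu hρ heq hineq hpsd hxb lam κ hκ Z W dZ hZ r hr β hβ
  have hE := energy_eq_re_rayleigh_of_eigen (F := F) (a := a) (b := b) hψ1 hHψ
  exact ⟨ha, hb, by linarith⟩

end LMIFormOp

/-! ## Pair-level form for an arbitrary condition set -/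

section EncodingOp

variable {V : Type*} [Fintype V] [DecidableEq V] {E : Type*} [Fintype E] {I : Type*} [Fintype I]
  {K : Type*} [Fintype K] {σ : K → Type*} [∀ q, Fintype (σ q)] [∀ q, DecidableEq (σ q)]
  {ω : K → Type*} [∀ q, Fintype (ω q)]

/-- **ENCODING OF A CONDITION SET (LMI form) WITH OPERATOR BOUNDS.** As `APosteriori.IsEncodingOfLMI`:
the programme ENCODES the condition set `P` on abstract pairs `(γ, Γ)` for the model `F` — every
`P`-feasible pair has a feasible image `y` with the trace bounds `τ_q`, objective `≤ Re E[γ, Γ]`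
(`rdmEnergy` at `F`'s tables) — and IN ADDITION the image satisfies `M_q(y) ⪯ x̄_q · 1` for every block
(the constants being operator bounds valid on the `P`-feasible set, e.g. Garrod–Percus `Γ ⪯ N · 1`,
`T1 ⪯ (9N+6) · 1`, `T2 ⪯ N(r+2) · 1` of the tree, transported to the programme's blocks by
`posSemidef_smul_one_sub_submatrix`). Asserts nothing. [cite: Jansson2007, §6 Cor. 6.1 (ii), p0013]
[cite: CancesStoltzLewin2006, §3 eqs. (7), (9)] -/
def IsEncodingOfLMIOp (F : Model k) (P : PairCondition k) (c : V → ℝ) (c₀ : ℝ) (u : V)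
    (rowE : E → V → ℝ) (rhs : E → ℝ) (rowI : I → V → ℝ) (upper : I → ℝ)
    (Cb : ∀ q, Matrix (σ q) (σ q) ℝ) (Fm : ∀ q, V → Matrix (σ q) (σ q) ℝ) (ρ : V → ℝ)
    (τ : K → ℝ) (xb : K → ℝ) : Prop :=
  ∀ γ Γ, P γ Γ →
    ∃ y : V → ℝ, y u = 1 ∧ (∀ v, v ≠ u → |y v| ≤ ρ v) ∧ (∀ r, ∑ v, rowE r v * y v = rhs r) ∧
      (∀ i, ∑ v, rowI i v * y v ≤ upper i) ∧ (∀ q, (Cb q + ∑ v, y v • Fm q v).PosSemidef) ∧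
      (∀ q, (Cb q + ∑ v, y v • Fm q v).trace ≤ τ q) ∧
      (∀ q, (xb q • (1 : Matrix (σ q) (σ q) ℝ) - (Cb q + ∑ v, y v • Fm q v)).PosSemidef) ∧
      ∑ v, c v * y v + c₀ ≤
        (rdmEnergy (fun p q => (F.h p q : ℂ)) (fun p q r s => (F.eri p q r s : ℂ)) (F.ecore : ℂ)
          γ Γ).re

omit [DecidableEq V] [Fintype E] [Fintype I] [Fintype K] in
/-- **Adding conditions keeps an encoding** (`Q ⇒ P`: the `Q`-feasible set is smaller).
[cite: CancesStoltzLewin2006, §3 eq. (7)] -/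
theorem IsEncodingOfLMIOp.anti {F : Model k} {P Q : PairCondition k} {c : V → ℝ} {c₀ : ℝ} {u : V}
    {rowE : E → V → ℝ} {rhs : E → ℝ} {rowI : I → V → ℝ} {upper : I → ℝ}
    {Cb : ∀ q, Matrix (σ q) (σ q) ℝ} {Fm : ∀ q, V → Matrix (σ q) (σ q) ℝ} {ρ : V → ℝ} {τ : K → ℝ}
    {xb : K → ℝ} (h : IsEncodingOfLMIOp F P c c₀ u rowE rhs rowI upper Cb Fm ρ τ xb)
    (hQP : ∀ γ Γ, Q γ Γ → P γ Γ) : IsEncodingOfLMIOp F Q c c₀ u rowE rhs rowI upper Cb Fm ρ τ xb :=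
  fun γ Γ hQ => h γ Γ (hQP γ Γ hQ)

omit [DecidableEq V] [Fintype E] [Fintype I] [Fintype K] in
/-- Forgetting the operator bounds gives the sibling's `IsEncodingOfLMI`.
[cite: CancesStoltzLewin2006, §3 eqs. (7), (9)] -/
theorem IsEncodingOfLMIOp.isEncodingOfLMI {F : Model k} {P : PairCondition k} {c : V → ℝ} {c₀ : ℝ}
    {u : V} {rowE : E → V → ℝ} {rhs : E → ℝ} {rowI : I → V → ℝ} {upper : I → ℝ}
    {Cb : ∀ q, Matrix (σ q) (σ q) ℝ} {Fm : ∀ q, V → Matrix (σ q) (σ q) ℝ} {ρ : V → ℝ} {τ : K → ℝ}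
    {xb : K → ℝ} (h : IsEncodingOfLMIOp F P c c₀ u rowE rhs rowI upper Cb Fm ρ τ xb) :
    IsEncodingOfLMI F P c c₀ u rowE rhs rowI upper Cb Fm ρ τ := by
  intro γ Γ hP
  obtain ⟨y, hyu, hρ, heq, hineq, hpsd, hτ, -, hobj⟩ := h γ Γ hP
  exact ⟨y, hyu, hρ, heq, hineq, hpsd, hτ, hobj⟩

omit [DecidableEq V] [Fintype E] [Fintype I] [Fintype K] in
/-- **An encoding (with operator bounds) of a SECTOR-NECESSARY condition set is a state-level encoding
with operator bounds**: the RDM pair of a unit vector of the sector is `P`-feasible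
(`IsNecessaryInSector`, CSL's `𝒞_app ⊃ 𝒞_N`) and the energy functional there is `⟨ψ, H_F ψ⟩`
(`rdmEnergy_rdm`). [cite: CancesStoltzLewin2006, §3 eqs. (7), (9)-(10)] -/
theorem IsEncodingOfLMIOp.isSectorRelaxationLMIOp {F : Model k} {P : PairCondition k} {a b : ℕ}
    {c : V → ℝ} {c₀ : ℝ} {u : V} {rowE : E → V → ℝ} {rhs : E → ℝ} {rowI : I → V → ℝ}
    {upper : I → ℝ} {Cb : ∀ q, Matrix (σ q) (σ q) ℝ} {Fm : ∀ q, V → Matrix (σ q) (σ q) ℝ}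
    {ρ : V → ℝ} {τ : K → ℝ} {xb : K → ℝ}
    (h : IsEncodingOfLMIOp F P c c₀ u rowE rhs rowI upper Cb Fm ρ τ xb) (hP : IsNecessaryInSector a b P) :
    IsSectorRelaxationLMIOp F a b c c₀ u rowE rhs rowI upper Cb Fm ρ τ xb := by
  intro ψ hψ hψ1
  obtain ⟨y, hyu, hρ, heq, hineq, hpsd, hτ, hxb, hobj⟩ := h _ _ (hP ψ hψ hψ1)
  refine ⟨y, hyu, hρ, heq, hineq, hpsd, hτ, hxb, ?_⟩
  rw [rdmEnergy_rdm _ _ _ hψ1] at hobj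
  exact hobj

/-- **THE BRIDGE FOR AN ARBITRARY NECESSARY CONDITION SET (LMI form, negative-part split).** Symmetric
`F`, `a, b ≤ k`, an LMI-form programme encoding a sector-necessary list `P` with trace bounds `τ_q`
and operator bounds `x̄_q`; a certificate `(λ, κ ≥ 0, Z_q + W_q W_qᵀ ⪰ d_q · 1)` with exact
stationarity residuals `r_v` proves `LowerRow F a b lo` for every rational
`lo ≤ β − Σ_{v ≠ u} |r_v| ρ_v − Σ_q |min(0, d_q)| τ_q − Σ_q x̄_q · tr(W_qᵀ W_q)`.
[cite: Jansson2007, §6 Cor. 6.1 (a), p0013 (via tree decl `JanssonChaykinKeil.lmiForm_bound_negSplit`)]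
[cite: CancesStoltzLewin2006, §3 eqs. (9)-(10)] -/
theorem lowerRow_of_isEncodingOfLMIOp_negSplit {F : Model k} (hF : F.IsSymmetric) {P : PairCondition k}
    {a b : ℕ} (ha : a ≤ k) (hb : b ≤ k) {c : V → ℝ} {c₀ : ℝ} {u : V} {rowE : E → V → ℝ}
    {rhs : E → ℝ} {rowI : I → V → ℝ} {upper : I → ℝ} {Cb : ∀ q, Matrix (σ q) (σ q) ℝ}
    {Fm : ∀ q, V → Matrix (σ q) (σ q) ℝ} {ρ : V → ℝ} {τ : K → ℝ} {xb : K → ℝ}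
    (henc : IsEncodingOfLMIOp F P c c₀ u rowE rhs rowI upper Cb Fm ρ τ xb)
    (hP : IsNecessaryInSector a b P) (lam : E → ℝ) (κ : I → ℝ) (hκ : ∀ i, 0 ≤ κ i)
    (Z : ∀ q, Matrix (σ q) (σ q) ℝ) (W : ∀ q, Matrix (σ q) (ω q) ℝ) (dZ : K → ℝ)
    (hZ : ∀ q, (Z q + W q * (W q)ᵀ - dZ q • (1 : Matrix (σ q) (σ q) ℝ)).PosSemidef) (r : V → ℝ)
    (hr : ∀ v, r v = c v - ∑ e, lam e * rowE e v + ∑ i, κ i * rowI i v - ∑ q, (Z q * Fm q v).trace)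
    (β : ℝ)
    (hβ : β = c₀ + r u + ∑ e, lam e * rhs e - ∑ i, κ i * upper i - ∑ q, (Z q * Cb q).trace)
    {lo : ℚ}
    (hlo : ((lo : ℚ) : ℝ) ≤ β - ∑ v ∈ Finset.univ.erase u, |r v| * ρ v
      - ∑ q, |min 0 (dZ q)| * τ q - ∑ q, xb q * ((W q)ᵀ * W q).trace) :
    LowerRow F a b lo :=
  lowerRow_of_isSectorRelaxationLMIOp_negSplit hF ha hb (henc.isSectorRelaxationLMIOp hP) lam κ hκ Z W
    dZ hZ r hr β hβ hlo

/-- **The same for an arbitrary necessary condition set, without trace bounds** (floor penalty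
`|min(0, d_q)| · s_q · x̄_q`). [cite: JanssonChaykinKeil2008, Lemma 3.1 / Thm 3.2 (via tree decl
`lmiForm_bound_negSplit_card`)] [cite: CancesStoltzLewin2006, §3 eqs. (9)-(10)] -/
theorem lowerRow_of_isEncodingOfLMIOp_negSplit_card {F : Model k} (hF : F.IsSymmetric)
    {P : PairCondition k} {a b : ℕ} (ha : a ≤ k) (hb : b ≤ k) {c : V → ℝ} {c₀ : ℝ} {u : V}
    {rowE : E → V → ℝ} {rhs : E → ℝ} {rowI : I → V → ℝ} {upper : I → ℝ}
    {Cb : ∀ q, Matrix (σ q) (σ q) ℝ} {Fm : ∀ q, V → Matrix (σ q) (σ q) ℝ} {ρ : V → ℝ} {τ : K → ℝ}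
    {xb : K → ℝ} (henc : IsEncodingOfLMIOp F P c c₀ u rowE rhs rowI upper Cb Fm ρ τ xb)
    (hP : IsNecessaryInSector a b P) (lam : E → ℝ) (κ : I → ℝ) (hκ : ∀ i, 0 ≤ κ i)
    (Z : ∀ q, Matrix (σ q) (σ q) ℝ) (W : ∀ q, Matrix (σ q) (ω q) ℝ) (dZ : K → ℝ)
    (hZ : ∀ q, (Z q + W q * (W q)ᵀ - dZ q • (1 : Matrix (σ q) (σ q) ℝ)).PosSemidef) (r : V → ℝ)
    (hr : ∀ v, r v = c v - ∑ e, lam e * rowE e v + ∑ i, κ i * rowI i v - ∑ q, (Z q * Fm q v).trace)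
    (β : ℝ)
    (hβ : β = c₀ + r u + ∑ e, lam e * rhs e - ∑ i, κ i * upper i - ∑ q, (Z q * Cb q).trace)
    {lo : ℚ}
    (hlo : ((lo : ℚ) : ℝ) ≤ β - ∑ v ∈ Finset.univ.erase u, |r v| * ρ v
      - ∑ q, |min 0 (dZ q)| * (Fintype.card (σ q) * xb q) - ∑ q, xb q * ((W q)ᵀ * W q).trace) :
    LowerRow F a b lo :=
  lowerRow_of_isSectorRelaxationLMIOp_negSplit_card hF ha hb (henc.isSectorRelaxationLMIOp hP) lam κ hκ
    Z W dZ hZ r hr β hβ hlo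

end EncodingOp

end APosteriori

end Summit.Ventures.CertifiedQuantumChemistry
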